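import Mathlib
import Summits.NavierStokesRegularity.NavierStokesRegularity.Theorems.EulerZoomLiouvillePowerGaugeEulerLiouvilleSeparableDichotomy
import Summits.NavierStokesRegularity.NavierStokesRegularity.Theorems.EulerZoomLiouvillePowerGaugeEulerLiouvilleSelfSimilarPressureSlavingPast
import Summits.NavierStokesRegularity.NavierStokesRegularity.Theorems.EulerZoomLiouvillePowerGaugeEulerLiouvilleSelfSimilarSeparablePast
import HarnessLib

/-!
# Crux `EulerZoomLiouville.PowerGaugeEulerLiouville` (stmt-NavierStokesRegularity-19832), stub `stub_nonSelfSimilarRest`: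
# EVERY `C¹`-MODULATED SEPARABLE PAST IS TRIVIAL (the a.e. `γ = 0` collapse bridged to the tree's literal rate-zero kill)

Helper file (theorems only; `--supports stmt-NavierStokesRegularity-19832`; def-free).  Hand leafhand-ns-eulerzoomliouville-11 g0;
last file of the separable lane.

* `CollapseBridge.cknA_modified_le` — the A.E.-TO-LITERAL BRIDGE for the `γ = 0` collapse: if `u(τ) = (T⋆ − τ)⁻¹ W` a.e. in `x` for a.e.
  `τ < T₁ ≤ T⋆`, the modified field (`(T⋆ − τ)⁻¹ W` before `T₁`, `u` after) has `A`-quantity at most that of `u` (a past slice of the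
  modified field is the limit of GOOD slices of `u` nearby: density of good times + continuity of `(T⋆ − τ)⁻²`).
* `CollapseBridge.ae_eq_zero_of_gauge_of_aeCollapseZero` — a member with `u(τ, x) = (T⋆ − τ)⁻¹ W(x)` for a.e. `(τ, x) ∈ (−∞,T₁) × ℝ³`
  (`T₁ ≤ 0`, `T₁ ≤ T⋆`, `W` arbitrary, `0 < ρ ≤ ½`) is trivial: the modified field is a member with the same `H`, `c`
  (`IsSuitableWeakSolutionOn.congr_ae`), its pressure is slaved (tree `PressureSlaving.inClass_pastSelfSimilarPressure`), and the tree's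
  rate-zero kill `SlowClock.separable_ae_eq_zero_past` applies.
* `CollapseBridge.ae_eq_zero_of_gauge_of_aeSeparableC1` / `Birth.nonSelfSimilar_of_aeSeparableC1` — **EVERY SEPARABLE PAST
  `u(τ, x) = θ(τ) U(x)` (a.e. on a past slab, `θ ∈ C¹(ℝ)`, `U` ARBITRARY) IS TRIVIAL** (`0 < ρ ≤ ½`): the separable dichotomy
  (`…SeparableDichotomy`) followed by the bridge.

WHAT THIS IS NOT: not a proof of the stub or of the crux; nothing about Navier–Stokes. [folklore]
-/

noncomputable section

-- flat `Theorems/<Route><Decl>…` files of one crux share the namespace of the crux (tree convention)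
set_option linter.dupNamespace false

open MeasureTheory Set Filter Topology Metric Function TopologicalSpace
open scoped RealInnerProductSpace NNReal ENNReal

namespace Summit.NavierStokesRegularity.NavierStokesRegularity.Theorems.PowerGaugeEulerLiouville

open Literature.Analysis Literature.Analysis.FunctionSpaces Literature.Analysis.FluidPDE

namespace CollapseBridge

/-- **The a.e.-to-literal bridge for the `A`-quantity.**  If for a.e. `τ < T₁` the slice `u(τ)` equals `(T⋆ − τ)⁻¹ W` a.e. (`T₁ ≤ T⋆`),
then the modified field (`(T⋆ − τ)⁻¹ W` before `T₁`, `u` after) has `A(a) ≤ A(a; u)` for every `a > 0`. [folklore] -/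
theorem cknA_modified_le {u : ℝ → EuclideanSpace ℝ (Fin 3) → EuclideanSpace ℝ (Fin 3)}
    {W : EuclideanSpace ℝ (Fin 3) → EuclideanSpace ℝ (Fin 3)} {T₁ Ts : ℝ} (hT₁ : T₁ ≤ 0) (hTs : T₁ ≤ Ts)
    (hslice : ∀ᵐ τ ∂(volume.restrict (Iio T₁)), u τ =ᵐ[volume] fun x => (Ts - τ)⁻¹ • W x) {a : ℝ} (ha : 0 < a) :
    cknA a (0 : ℝ × EuclideanSpace ℝ (Fin 3)) (fun τ x => if τ < T₁ then (Ts - τ)⁻¹ • W x else u τ x) ≤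
      cknA a (0 : ℝ × EuclideanSpace ℝ (Fin 3)) u := by
  unfold cknA
  refine iSup₂_le fun t ht => ?_
  have ht' : -(a ^ 2) < t ∧ t < 0 := by simpa using ht
  set S : ℝ≥0∞ := ⨆ τ ∈ Ioo ((0 : ℝ × EuclideanSpace ℝ (Fin 3)).1 - a ^ 2) (0 : ℝ × EuclideanSpace ℝ (Fin 3)).1,
    (ENNReal.ofReal a)⁻¹ * ∫⁻ x in ball (0 : ℝ × EuclideanSpace ℝ (Fin 3)).2 a, ‖u τ x‖ₑ ^ 2 with hS
  have hle : ∀ τ : ℝ, -(a ^ 2) < τ → τ < 0 →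
      (ENNReal.ofReal a)⁻¹ * ∫⁻ x in ball (0 : ℝ × EuclideanSpace ℝ (Fin 3)).2 a, ‖u τ x‖ₑ ^ 2 ≤ S := by
    intro τ h1 h2
    have hτ : τ ∈ Ioo ((0 : ℝ × EuclideanSpace ℝ (Fin 3)).1 - a ^ 2) (0 : ℝ × EuclideanSpace ℝ (Fin 3)).1 := by
      simpa using And.intro h1 h2
    exact le_iSup₂ (f := fun τ (_ : τ ∈ Ioo ((0 : ℝ × EuclideanSpace ℝ (Fin 3)).1 - a ^ 2) (0 : ℝ × EuclideanSpace ℝ (Fin 3)).1) =>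
      (ENNReal.ofReal a)⁻¹ * ∫⁻ x in ball (0 : ℝ × EuclideanSpace ℝ (Fin 3)).2 a, ‖u τ x‖ₑ ^ 2) τ hτ
  by_cases htT : t < T₁
  swap
  · have e1 : ∫⁻ x in ball (0 : ℝ × EuclideanSpace ℝ (Fin 3)).2 a,
        ‖(fun τ x => if τ < T₁ then (Ts - τ)⁻¹ • W x else u τ x) t x‖ₑ ^ 2 =
        ∫⁻ x in ball (0 : ℝ × EuclideanSpace ℝ (Fin 3)).2 a, ‖u t x‖ₑ ^ 2 := by
      refine lintegral_congr fun x => ?_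
      simp only [if_neg htT]
    rw [e1]
    exact hle t ht'.1 ht'.2
  -- a past slice: approximate `t` by good times
  set IW : ℝ≥0∞ := ∫⁻ x in ball (0 : ℝ × EuclideanSpace ℝ (Fin 3)).2 a, ‖W x‖ₑ ^ 2 with hIW
  have e1 : ∫⁻ x in ball (0 : ℝ × EuclideanSpace ℝ (Fin 3)).2 a,
      ‖(fun τ x => if τ < T₁ then (Ts - τ)⁻¹ • W x else u τ x) t x‖ₑ ^ 2 = ‖(Ts - t)⁻¹‖ₑ ^ 2 * IW := by
    rw [hIW, ← lintegral_const_mul' _ _ (ENNReal.pow_ne_top enorm_ne_top)]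
    refine lintegral_congr fun x => ?_
    simp only [if_pos htT, enorm_smul, mul_pow]
  rw [e1]
  -- good times near `t`
  have hseq : ∀ n : ℕ, ∃ τ : ℝ, (|τ - t| < 1 / ((n : ℝ) + 1) ∧ -(a ^ 2) < τ ∧ τ < T₁) ∧
      u τ =ᵐ[volume] fun x => (Ts - τ)⁻¹ • W x := by
    intro n
    have hn : (0 : ℝ) < 1 / ((n : ℝ) + 1) := by positivity
    set lo : ℝ := max (-(a ^ 2)) (t - 1 / ((n : ℝ) + 1)) with hlo
    set hi : ℝ := min T₁ (t + 1 / ((n : ℝ) + 1)) with hhi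
    have hlo_lt : lo < t := max_lt ht'.1 (by linarith)
    have hhi_gt : t < hi := lt_min htT (by linarith)
    have hwin : volume (Ioo lo hi) ≠ 0 := by
      rw [Real.volume_Ioo]; exact (ENNReal.ofReal_pos.2 (by linarith)).ne'
    have hsub : Ioo lo hi ⊆ Iio T₁ := fun τ hτ => lt_of_lt_of_le hτ.2 (min_le_left _ _)
    obtain ⟨τ, hτ, hgood⟩ := Measure.exists_mem_of_measure_ne_zero_of_ae hwin (ae_restrict_of_ae_restrict_of_subset hsub hslice)
    refine ⟨τ, ⟨?_, lt_of_le_of_lt (le_max_left _ _) hτ.1, lt_of_lt_of_le hτ.2 (min_le_left _ _)⟩, hgood⟩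
    rw [abs_lt]
    have h1 : t - 1 / ((n : ℝ) + 1) < τ := lt_of_le_of_lt (le_max_right _ _) hτ.1
    have h2 : τ < t + 1 / ((n : ℝ) + 1) := lt_of_lt_of_le hτ.2 (min_le_right _ _)
    constructor <;> linarith
  choose f hf hfgood using hseq
  -- each good slice is bounded by `S`
  have hbound : ∀ n, (ENNReal.ofReal a)⁻¹ * (‖(Ts - f n)⁻¹‖ₑ ^ 2 * IW) ≤ S := by
    intro n
    have e2 : ‖(Ts - f n)⁻¹‖ₑ ^ 2 * IW = ∫⁻ x in ball (0 : ℝ × EuclideanSpace ℝ (Fin 3)).2 a, ‖u (f n) x‖ₑ ^ 2 := by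
      rw [hIW, ← lintegral_const_mul' _ _ (ENNReal.pow_ne_top enorm_ne_top)]
      refine lintegral_congr_ae (ae_restrict_of_ae ?_)
      filter_upwards [hfgood n] with x hx
      rw [hx, enorm_smul, mul_pow]
    rw [e2]
    exact hle (f n) (hf n).2.1 (lt_of_lt_of_le (hf n).2.2 hT₁)
  -- the limit
  have hft : Tendsto f atTop (𝓝 t) := by
    refine tendsto_iff_norm_sub_tendsto_zero.2 ?_
    refine squeeze_zero (fun n => norm_nonneg _) (fun n => ?_) tendsto_one_div_add_atTop_nhds_zero_nat
    rw [Real.norm_eq_abs]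
    exact (hf n).1.le
  have hTt : Ts - t ≠ 0 := by linarith
  have hθ : Tendsto (fun n => ((Ts - f n)⁻¹) ^ 2) atTop (𝓝 (((Ts - t)⁻¹) ^ 2)) := by
    have h1 : Tendsto (fun n => Ts - f n) atTop (𝓝 (Ts - t)) := tendsto_const_nhds.sub hft
    exact (h1.inv₀ hTt).pow 2
  have hθe : Tendsto (fun n => ‖(Ts - f n)⁻¹‖ₑ ^ 2) atTop (𝓝 (‖(Ts - t)⁻¹‖ₑ ^ 2)) := by
    have e : ∀ r : ℝ, ‖r‖ₑ ^ 2 = ENNReal.ofReal (r ^ 2) := fun r => by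
      rw [Real.enorm_eq_ofReal_abs, ← ENNReal.ofReal_pow (abs_nonneg _), sq_abs]
    simp_rw [e]
    exact ENNReal.tendsto_ofReal hθ
  have hne0 : ‖(Ts - t)⁻¹‖ₑ ^ 2 ≠ 0 := pow_ne_zero _ (by rw [ne_eq, enorm_eq_zero]; exact inv_ne_zero hTt)
  have hlim : Tendsto (fun n => (ENNReal.ofReal a)⁻¹ * (‖(Ts - f n)⁻¹‖ₑ ^ 2 * IW)) atTop
      (𝓝 ((ENNReal.ofReal a)⁻¹ * (‖(Ts - t)⁻¹‖ₑ ^ 2 * IW))) := by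
    refine ENNReal.Tendsto.const_mul (ENNReal.Tendsto.mul_const hθe (Or.inl hne0)) (Or.inr ?_)
    exact ENNReal.inv_ne_top.2 (by rw [ne_eq, ENNReal.ofReal_eq_zero, not_le]; exact ha)
  exact le_of_tendsto' hlim hbound

/-- **The a.e. `γ = 0` collapse is trivial** (`0 < ρ ≤ ½`): `u(τ, x) = (T⋆ − τ)⁻¹ W(x)` for a.e. `(τ, x) ∈ (−∞,T₁) × ℝ³`, `T₁ ≤ 0`,
`T₁ ≤ T⋆`, `W` arbitrary ⇒ `u = 0` a.e. (modified member + tree `PressureSlaving.inClass_pastSelfSimilarPressure` +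
`SlowClock.separable_ae_eq_zero_past`). [folklore; cf. ChaeShvydkoy2013 §2.2] -/
theorem ae_eq_zero_of_gauge_of_aeCollapseZero {ρ : ℝ} (hρ : 0 < ρ) (hρh : ρ ≤ 1 / 2)
    {u : ℝ → EuclideanSpace ℝ (Fin 3) → EuclideanSpace ℝ (Fin 3)} {p : ℝ → EuclideanSpace ℝ (Fin 3) → ℝ}
    {H : ℝ → EuclideanSpace ℝ (Fin 3) → EuclideanSpace ℝ (Fin 3) →L[ℝ] EuclideanSpace ℝ (Fin 3)} {c : ℝ≥0}
    (hsw : IsSuitableWeakSolutionOn (slab (EuclideanSpace ℝ (Fin 3)) (Iio 0) isOpen_Iio) 0 0 u p)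
    (hH : HasWeakSpatialGradientOn (slab (EuclideanSpace ℝ (Fin 3)) (Iio 0) isOpen_Iio) u H)
    (hc : ∀ a : ℝ, 0 < a → ENNReal.ofReal (a ^ (2 * ρ)) * cknA a (0 : ℝ × EuclideanSpace ℝ (Fin 3)) u +
        ENNReal.ofReal (a ^ ρ) * cknE a (0 : ℝ × EuclideanSpace ℝ (Fin 3)) H +
        ENNReal.ofReal (a ^ (2 * ρ)) * cknD a (0 : ℝ × EuclideanSpace ℝ (Fin 3)) p ≤ (c : ℝ≥0∞))
    {T₁ Ts : ℝ} (hT₁ : T₁ ≤ 0) (hTs : T₁ ≤ Ts) {W : EuclideanSpace ℝ (Fin 3) → EuclideanSpace ℝ (Fin 3)}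
    (hU : ∀ᵐ z ∂(volume.restrict (Iio T₁ ×ˢ (univ : Set (EuclideanSpace ℝ (Fin 3))))), u z.1 z.2 = (Ts - z.1)⁻¹ • W z.2) :
    uncurry u =ᵐ[volume.restrict (Iio (0 : ℝ) ×ˢ (univ : Set (EuclideanSpace ℝ (Fin 3))))] 0 := by
  classical
  set v : ℝ → EuclideanSpace ℝ (Fin 3) → EuclideanSpace ℝ (Fin 3) :=
    fun τ x => if τ < T₁ then (Ts - τ)⁻¹ • W x else u τ x with hv
  -- `v = u` a.e. on the slab
  have hvu : ∀ᵐ z ∂(volume.restrict ((slab (EuclideanSpace ℝ (Fin 3)) (Iio 0) isOpen_Iio : Opens (ℝ × EuclideanSpace ℝ (Fin 3))) :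
      Set (ℝ × EuclideanSpace ℝ (Fin 3)))), uncurry u z = uncurry v z := by
    rw [coe_slab]
    have h1 : ∀ᵐ z ∂(volume.restrict (Iio (0 : ℝ) ×ˢ (univ : Set (EuclideanSpace ℝ (Fin 3))))),
        z ∈ Iio T₁ ×ˢ (univ : Set (EuclideanSpace ℝ (Fin 3))) → u z.1 z.2 = (Ts - z.1)⁻¹ • W z.2 :=
      ae_restrict_of_ae (ae_imp_of_ae_restrict hU)
    filter_upwards [h1] with z hz
    by_cases ht : z.1 < T₁
    · simp only [uncurry, hv, if_pos ht]
      exact hz ⟨ht, mem_univ _⟩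
    · simp only [uncurry, hv, if_neg ht]
  have hsw' : IsSuitableWeakSolutionOn (slab (EuclideanSpace ℝ (Fin 3)) (Iio 0) isOpen_Iio) 0 0 v p :=
    hsw.congr_ae hvu (Eventually.of_forall fun _ => rfl)
  have hH' : HasWeakSpatialGradientOn (slab (EuclideanSpace ℝ (Fin 3)) (Iio 0) isOpen_Iio) v H := hH.congr_ae hvu
  have hslice := AffinePast.ae_ae_of_ae_slab (P := fun τ x => u τ x = (Ts - τ)⁻¹ • W x) hU
  have hc' : ∀ a : ℝ, 0 < a → ENNReal.ofReal (a ^ (2 * ρ)) * cknA a (0 : ℝ × EuclideanSpace ℝ (Fin 3)) v +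
      ENNReal.ofReal (a ^ ρ) * cknE a (0 : ℝ × EuclideanSpace ℝ (Fin 3)) H +
      ENNReal.ofReal (a ^ (2 * ρ)) * cknD a (0 : ℝ × EuclideanSpace ℝ (Fin 3)) p ≤ (c : ℝ≥0∞) := by
    intro a ha
    refine le_trans ?_ (hc a ha)
    gcongr
    exact cknA_modified_le hT₁ hTs hslice ha
  -- the literal rate-zero ansatz for `v`
  have hv_lit : ∀ τ : ℝ, τ < T₁ → v τ = fun x => selfSimilarCollapse 0 Ts W τ (x - 0) := by
    intro τ hτ
    funext x
    rw [hv]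
    simp only [if_pos hτ]
    rw [selfSimilarCollapse_apply, neg_zero, Real.rpow_zero, one_smul, zero_sub, Real.rpow_neg_one, sub_zero]
  obtain ⟨Q, p', -, hp, -, h'⟩ :=
    PressureSlaving.inClass_pastSelfSimilarPressure (g := 0) (by linarith) hT₁ hTs ⟨hsw', hH', hc'⟩ hv_lit
  have h0 := SlowClock.separable_ae_eq_zero_past hρ hρh hT₁ hTs 0 h'.1 h'.2.1 h'.2.2 hv_lit hp
  rw [coe_slab] at hvu
  filter_upwards [h0, hvu] with z hz hz'
  rw [hz']
  exact hz

/-- **EVERY `C¹`-MODULATED SEPARABLE PAST IS TRIVIAL** (`0 < ρ ≤ ½`): `u(τ, x) = θ(τ) U(x)` for a.e. `(τ, x) ∈ (−∞,T₁) × ℝ³`,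
`T₁ ≤ 0`, `θ ∈ C¹(ℝ)`, `U` arbitrary ⇒ `u = 0` a.e. on the slab (separable dichotomy + the bridged rate-zero kill). [folklore] -/
theorem ae_eq_zero_of_gauge_of_aeSeparableC1 {ρ : ℝ} (hρ : 0 < ρ) (hρh : ρ ≤ 1 / 2)
    {u : ℝ → EuclideanSpace ℝ (Fin 3) → EuclideanSpace ℝ (Fin 3)} {p : ℝ → EuclideanSpace ℝ (Fin 3) → ℝ}
    {H : ℝ → EuclideanSpace ℝ (Fin 3) → EuclideanSpace ℝ (Fin 3) →L[ℝ] EuclideanSpace ℝ (Fin 3)} {c : ℝ≥0}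
    (hsw : IsSuitableWeakSolutionOn (slab (EuclideanSpace ℝ (Fin 3)) (Iio 0) isOpen_Iio) 0 0 u p)
    (hH : HasWeakSpatialGradientOn (slab (EuclideanSpace ℝ (Fin 3)) (Iio 0) isOpen_Iio) u H)
    (hc : ∀ a : ℝ, 0 < a → ENNReal.ofReal (a ^ (2 * ρ)) * cknA a (0 : ℝ × EuclideanSpace ℝ (Fin 3)) u +
        ENNReal.ofReal (a ^ ρ) * cknE a (0 : ℝ × EuclideanSpace ℝ (Fin 3)) H +
        ENNReal.ofReal (a ^ (2 * ρ)) * cknD a (0 : ℝ × EuclideanSpace ℝ (Fin 3)) p ≤ (c : ℝ≥0∞))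
    {T₁ : ℝ} (hT₁ : T₁ ≤ 0) {θ : ℝ → ℝ} (hθ1 : ContDiff ℝ 1 θ) {U : EuclideanSpace ℝ (Fin 3) → EuclideanSpace ℝ (Fin 3)}
    (hU : ∀ᵐ z ∂(volume.restrict (Iio T₁ ×ˢ (univ : Set (EuclideanSpace ℝ (Fin 3))))), u z.1 z.2 = θ z.1 • U z.2) :
    uncurry u =ᵐ[volume.restrict (Iio (0 : ℝ) ×ˢ (univ : Set (EuclideanSpace ℝ (Fin 3))))] 0 := by
  rcases SeparableEuler.trivial_or_aeCollapseZero hρ hsw hH hc hT₁ hθ1 hU with h | ⟨Ts, hTs, W, hW⟩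
  · exact h
  · exact ae_eq_zero_of_gauge_of_aeCollapseZero hρ hρh hsw hH hc hT₁ hTs hW

end CollapseBridge

/-- **Binder language: EVERY `C¹`-MODULATED SEPARABLE PAST IS TRIVIAL** — `u(τ, x) = θ(τ) U(x)` for a.e. `(τ, x) ∈ (−∞,T₁) × ℝ³`,
some `T₁ ≤ 0`, `θ ∈ C¹(ℝ)` and `U : ℝ³ → ℝ³` ARBITRARY ⇒ `u = 0` a.e., in the window `0 < ρ ≤ ½` of the open stubs
(`CollapseBridge.ae_eq_zero_of_gauge_of_aeSeparableC1`). [folklore] -/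
theorem Birth.nonSelfSimilar_of_aeSeparableC1 :
    ∀ ρ : ℝ, 0 < ρ → ρ ≤ 1 / 2 →
      ∀ (u : ℝ → EuclideanSpace ℝ (Fin 3) → EuclideanSpace ℝ (Fin 3)) (p : ℝ → EuclideanSpace ℝ (Fin 3) → ℝ)
        (H : ℝ → EuclideanSpace ℝ (Fin 3) → EuclideanSpace ℝ (Fin 3) →L[ℝ] EuclideanSpace ℝ (Fin 3)) (c : ℝ≥0),
        Birth.InClass ρ u p H c →
          (∃ T₁ : ℝ, T₁ ≤ 0 ∧ ∃ θ : ℝ → ℝ, ∃ U : EuclideanSpace ℝ (Fin 3) → EuclideanSpace ℝ (Fin 3),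
              ContDiff ℝ 1 θ ∧
              ∀ᵐ z ∂(volume.restrict (Iio T₁ ×ˢ (univ : Set (EuclideanSpace ℝ (Fin 3))))), u z.1 z.2 = θ z.1 • U z.2) →
          uncurry u =ᵐ[volume.restrict (Iio (0 : ℝ) ×ˢ (univ : Set (EuclideanSpace ℝ (Fin 3))))] 0 := by
  intro ρ hρ hρh u p H c hcl h
  obtain ⟨T₁, hT₁, θ, U, hθ1, hU⟩ := h
  exact CollapseBridge.ae_eq_zero_of_gauge_of_aeSeparableC1 hρ hρh hcl.1 hcl.2.1 hcl.2.2 hT₁ hθ1 hU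

end Summit.NavierStokesRegularity.NavierStokesRegularity.Theorems.PowerGaugeEulerLiouville

end
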